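import Summits.AtomisticToContinuum.Crystallization.Theorems.ThreeConeCertificateKeplerBoundBulkTails
import Summits.AtomisticToContinuum.Crystallization.Theorems.ThreeConeCertificateKeplerBoundBulkMatching
import Summits.AtomisticToContinuum.Crystallization.Theorems.ChargedEnergyGap.Negative.BlocksEnergy

/-!
# `KeplerBound` (stmt-AtomisticToContinuum-11961) from bulk rigidity, IIc: the Lennard-Jones
# site energy of a matched particle

Support file for the item `ThreeConeCertificate.KeplerBound`, joining parts IIa (uniform tails)
and IIb (matching): if the `R`-environment of the particle `x i` of a `δ`-separated configuration
is two-way `ε`-matched to `x i + A (P.points − y)` (`y` a point of the `δ`-separated periodic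
configuration `P`, `2ε < δ`, `ε ≤ 1`, `R ≥ 2`), then
`siteEnergy V_LJ x i ≥ Σ_{q ∈ T} V_LJ(dist q y) − #T·ω − (250/6) δ⁻⁵/(R − 1)`,
`T = {q ∈ P.points : q ≠ y, dist q y ≤ R}`, `ω` a modulus of continuity of `V_LJ` on `[δ, R + 1]`
at scale `ε` (`siteEnergy_ge_of_matchedAt`); and the site sum of `P` at `y` is at most the
truncated sum `Σ_{q ∈ T} V_LJ(dist q y)` once `R ≥ 1` (`siteSum_le_sum_near`: the dropped terms
are `≤ 0`).  Used by `BulkDefectVanish → KeplerBound` (part III) and by the local-limit line.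
All `[folklore]`.
-/

noncomputable section

open scoped BigOperators Topology
open Filter Set Metric

namespace Summit.AtomisticToContinuum.Crystallization.Theorems.KeplerBoundBulk

open Literature.MathematicalPhysics.StatisticalMechanics
open Summit.AtomisticToContinuum.Crystallization.Theorems.SlackRigidityNegative
open Summit.AtomisticToContinuum.Crystallization.Theorems.ChargedEnergyGapNegative.Blocks (siteSum)

/-! ## § The Lennard-Jones site energy of a matched particle -/

/-- **Site energy of a matched particle (Lennard-Jones).** Under the two-way matching of
`exists_matching` (`2ε < δ`, `ε ≤ 1`, `R ≥ 2`) and a modulus of continuity `ω` of `V_LJ` on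
`[δ, R + 1]` at scale `ε`:
`siteEnergy V_LJ x i ≥ Σ_{q ∈ T} V_LJ(dist q y) − #T·ω − (1/6)(R − 1)⁻¹ · 250 δ⁻⁵`. [folklore] -/
theorem siteEnergy_ge_of_matchedAt {P : PeriodicConfiguration 3} {y : E3} {R ε δ ω : ℝ} {N : ℕ}
    {x : Fin N → E3} {i : Fin N} {A : E3 →ₗᵢ[ℝ] E3} {T : Finset E3}
    (hT : ∀ q, q ∈ T ↔ q ∈ P.points ∧ q ≠ y ∧ dist q y ≤ R) (hy : y ∈ P.points)
    (ha : ∀ q ∈ P.points, dist q y ≤ R → ∃ j, dist (x j) (x i + A (q - y)) ≤ ε)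
    (hb : ∀ j, dist (x j) (x i) ≤ R → ∃ q ∈ P.points, dist (x j) (x i + A (q - y)) ≤ ε)
    (hxsep : ∀ k l, k ≠ l → δ ≤ dist (x k) (x l))
    (hPsep : ∀ p ∈ P.points, ∀ q ∈ P.points, p ≠ q → δ ≤ dist p q)
    (hδ : 0 < δ) (hε : 0 ≤ ε) (hεδ : 2 * ε < δ) (hε1 : ε ≤ 1) (hR : 2 ≤ R)
    (hω : ∀ s t : ℝ, δ ≤ s → δ ≤ t → s ≤ R + 1 → t ≤ R + 1 → |s - t| ≤ ε →
      |lennardJones s - lennardJones t| ≤ ω) :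
    ∑ q ∈ T, lennardJones (dist q y) - T.card * ω - 1 / 6 * ((R - 1)⁻¹ * (250 * δ⁻¹ ^ 5)) ≤
      siteEnergy lennardJones x i := by
  obtain ⟨φ, h1, h2, h3, h4⟩ := exists_matching hT hy ha hb hxsep hPsep hε hεδ
  have hρ : 0 < R - ε := by linarith
  have hω' : ∀ q ∈ T, |lennardJones (dist (x i) (x (φ q))) - lennardJones (dist q y)| ≤ ω := by
    intro q hq
    obtain ⟨hqP, hqy, hqR⟩ := (hT q).1 hq
    have hd := h3 q hq
    have hd' := abs_sub_le_iff.1 hd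
    have ht : δ ≤ dist q y := hPsep q hqP y hy hqy
    have hs : δ ≤ dist (x i) (x (φ q)) := hxsep i (φ q) (h1 q hq).symm
    exact hω _ _ hs ht (by linarith [hd'.1]) (by linarith) hd
  have hneg : ∀ k, k ≠ i → R - ε < dist (x i) (x k) → lennardJones (dist (x i) (x k)) ≤ 0 :=
    fun k _ hk => lennardJones_nonpos (by linarith)
  have hmain := siteEnergy_ge_of_matching lennardJones x i φ (fun q => dist q y) h1 h2 hω' h4 hneg
  have hfar := sum_lennardJones_far_ge x hδ hxsep i hρ
  have hinv : (R - ε)⁻¹ ≤ (R - 1)⁻¹ := (inv_le_inv₀ hρ (by linarith)).2 (by linarith)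
  have hC : 0 ≤ 250 * δ⁻¹ ^ 5 := by positivity
  have hmono : 1 / 6 * ((R - ε)⁻¹ * (250 * δ⁻¹ ^ 5)) ≤ 1 / 6 * ((R - 1)⁻¹ * (250 * δ⁻¹ ^ 5)) := by
    nlinarith [mul_le_mul_of_nonneg_right hinv hC]
  linarith

/-! ## § Truncating the site sum of `P` from above -/

/-- **The site sum is at most its truncation** at any radius `R ≥ 1`: the dropped terms
`V_LJ(dist q y)`, `dist q y > R ≥ 1`, are non-positive and the family is summable. [folklore] -/
theorem siteSum_le_sum_near (P : PeriodicConfiguration 3) {y : E3} {R : ℝ} (hR : 1 ≤ R)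
    {T : Finset E3} (hT : ∀ q, q ∈ T ↔ q ∈ P.points ∧ q ≠ y ∧ dist q y ≤ R) :
    siteSum P lennardJones y ≤ ∑ q ∈ T, lennardJones (dist q y) := by
  classical
  have hsum : Summable fun q : {q : E3 // q ∈ P.points ∧ q ≠ y} => lennardJones (dist y q.1) :=
    P.summable_lennardJones_dist_three y
  set s : Finset {q : E3 // q ∈ P.points ∧ q ≠ y} := T.subtype fun q => q ∈ P.points ∧ q ≠ y
    with hs
  have hsplit := hsum.sum_add_tsum_compl (s := s)
  have htail : ∑' q : ((s : Set {q : E3 // q ∈ P.points ∧ q ≠ y})ᶜ : Set _),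
      lennardJones (dist y q.1.1) ≤ 0 := by
    refine tsum_nonpos fun q => lennardJones_nonpos ?_
    have hq : ¬ (q.1.1 ∈ T) := fun h =>
      q.2 (Finset.mem_coe.2 (show q.1 ∈ T.subtype (fun q => q ∈ P.points ∧ q ≠ y) from
        Finset.mem_subtype.2 h))
    have hq' : ¬ dist q.1.1 y ≤ R := fun h => hq ((hT _).2 ⟨q.1.2.1, q.1.2.2, h⟩)
    rw [dist_comm]
    linarith [not_le.1 hq']
  have hfin : ∑ q ∈ s, lennardJones (dist y q.1) = ∑ q ∈ T, lennardJones (dist q y) := by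
    have h3 := Finset.sum_subtype_eq_sum_filter (s := T) (fun q : E3 => lennardJones (dist y q))
      (p := fun q => q ∈ P.points ∧ q ≠ y)
    rw [Finset.filter_true_of_mem (fun q hq => ⟨((hT q).1 hq).1, ((hT q).1 hq).2.1⟩)] at h3
    rw [hs, h3]
    exact Finset.sum_congr rfl fun q _ => by rw [dist_comm]
  unfold siteSum
  linarith

end Summit.AtomisticToContinuum.Crystallization.Theorems.KeplerBoundBulk

end
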